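import Mathlib.NumberTheory.LSeries.RiemannZeta
import Mathlib.NumberTheory.LSeries.Nonvanishing
import Mathlib.Analysis.SpecialFunctions.Gamma.Deligne
import Literature.NumberTheory.LFunctions.CentralOrderForcedByStructure
import HarnessLib

/-!
# The Riemann zeta function vanishes to even order at the central point `s = 1/2`

Topic `NumberTheory/LFunctions`. Riemann's functional equation `ξ(1 - s) = ξ(s)`
(Titchmarsh, *The Theory of the Riemann Zeta-Function*, §2.1 (2.1.9) and §2.6 (2.6.4); Mathlib
`completedRiemannZeta_one_sub`, stated for every `s`) has sign `+1` at the centre `s = 1/2`, so the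
parity mechanism (`CentralOrder.sign_eq_neg_one_pow`: order `n` at the centre forces `w = (-1)ⁿ`)
makes the order of vanishing of `Λ(s) = π^{-s/2} Γ(s/2) ζ(s)` at `s = 1/2` EVEN, hence also that of
`ζ(s)` itself (`Γ_ℝ(1/2) ≠ 0`); the order is finite (`ζ(2) ≠ 0` and the identity theorem on
`ℂ ∖ {1}`). Everything is PROVED from Mathlib alone plus the tree's parity lemma. (That in fact
`ζ(1/2) ≈ -1.46 ≠ 0`, so the order is `0`, is a numerical statement not attempted here.)

* `analyticAt_completedRiemannZeta_half`, `even_analyticOrderNatAt_completedRiemannZeta_half`;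
* `analyticOrderAt_riemannZeta_half_eq`, `analyticOrderAt_riemannZeta_half_ne_top`,
  `even_analyticOrderNatAt_riemannZeta_half`, `two_le_analyticOrderNatAt_riemannZeta_half_of_eq_zero`.

## References

* [Titchmarsh1986] E. C. Titchmarsh, *The Theory of the Riemann Zeta-Function*, 2nd ed. (1986),
  §2.1 (2.1.9) / §2.6 (functional equation `ξ(s) = ξ(1-s)`).
-/

noncomputable section

open Filter Set Complex

open scoped Topology

namespace Literature.NumberTheory.LFunctions

/-- **`Λ(s) = π^{-s/2} Γ(s/2) ζ(s)` is analytic at `s = 1/2`** (Mathlib: differentiable away from the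
poles `0` and `1`). [cite: Titchmarsh1986, §2.1 (2.1.9)] -/
theorem analyticAt_completedRiemannZeta_half : AnalyticAt ℂ completedRiemannZeta ((1 : ℂ) / 2) := by
  have hopen : IsOpen ({0, 1}ᶜ : Set ℂ) := (Set.toFinite _).isClosed.isOpen_compl
  have hdiff : DifferentiableOn ℂ completedRiemannZeta ({0, 1}ᶜ : Set ℂ) := fun s hs ↦
    (differentiableAt_completedZeta (fun h ↦ hs (by simp [h])) (fun h ↦ hs (by simp [h])))
      |>.differentiableWithinAt
  exact hdiff.analyticAt (hopen.mem_nhds (by norm_num))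

/-- **`ord_{s=1/2} Λ(s)` is even**: the functional equation `Λ(1 - s) = Λ(s)` (Mathlib
`completedRiemannZeta_one_sub`) has sign `+1`, and a function analytic at the centre with
`Λ(c - s) = w Λ(s)` and finite order `n` there has `w = (-1)ⁿ` (`CentralOrder.sign_eq_neg_one_pow`);
an infinite order gives the `ℕ`-valued order `0`. [cite: Titchmarsh1986, §2.6 (2.6.4)] -/
theorem even_analyticOrderNatAt_completedRiemannZeta_half :
    Even (analyticOrderNatAt completedRiemannZeta ((1 : ℂ) / 2)) := by
  have hFE : ∀ s : ℂ, completedRiemannZeta (1 - s) = 1 * completedRiemannZeta s := fun s ↦ by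
    rw [one_mul, completedRiemannZeta_one_sub]
  rcases eq_or_ne (analyticOrderAt completedRiemannZeta ((1 : ℂ) / 2)) ⊤ with htop | htop
  · rw [analyticOrderNatAt, htop, ENat.toNat_top]
    exact Even.zero
  · exact (CentralOrder.even_analyticOrderNatAt_iff analyticAt_completedRiemannZeta_half hFE
      (by norm_num) htop).mpr rfl

/-- **`ord_{s=1/2} ζ(s) = ord_{s=1/2} Λ(s)`**: near `1/2`, `ζ(s) = Λ(s) · Γ_ℝ(s)⁻¹` (Mathlib
`riemannZeta_def_of_ne_zero`) with `Γ_ℝ⁻¹` entire (`differentiable_Gammaℝ_inv`) and non-zero at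
`1/2` (`Gammaℝ_ne_zero_of_re_pos`), a factor of order `0`. [cite: Titchmarsh1986, §2.1 (2.1.9)] -/
theorem analyticOrderAt_riemannZeta_half_eq :
    analyticOrderAt riemannZeta ((1 : ℂ) / 2) = analyticOrderAt completedRiemannZeta ((1 : ℂ) / 2) := by
  -- `ζ = Λ · Γ_ℝ⁻¹` on the neighbourhood `{0}ᶜ` of `1/2`
  have hev : riemannZeta =ᶠ[𝓝 ((1 : ℂ) / 2)]
      completedRiemannZeta * fun s ↦ (Gammaℝ s)⁻¹ := by
    filter_upwards [isOpen_compl_singleton.mem_nhds (show ((1 : ℂ) / 2) ∈ ({0}ᶜ : Set ℂ) by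
      norm_num)] with s hs
    rw [Pi.mul_apply, riemannZeta_def_of_ne_zero hs, div_eq_mul_inv]
  have hΓan : AnalyticAt ℂ (fun s ↦ (Gammaℝ s)⁻¹) ((1 : ℂ) / 2) :=
    differentiable_Gammaℝ_inv.analyticAt _
  have hΓ0 : analyticOrderAt (fun s ↦ (Gammaℝ s)⁻¹) ((1 : ℂ) / 2) = 0 :=
    hΓan.analyticOrderAt_eq_zero.mpr
      (inv_ne_zero (Gammaℝ_ne_zero_of_re_pos (by norm_num)))
  rw [analyticOrderAt_congr hev, analyticOrderAt_mul analyticAt_completedRiemannZeta_half hΓan, hΓ0,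
    add_zero]

/-- `ζ` is holomorphic on `ℂ ∖ {1}` (Mathlib `differentiableAt_riemannZeta`), hence analytic there.
[cite: Titchmarsh1986, §2.1] -/
theorem analyticOnNhd_riemannZeta_compl_one : AnalyticOnNhd ℂ riemannZeta ({1}ᶜ : Set ℂ) := by
  have hdiff : DifferentiableOn ℂ riemannZeta ({1}ᶜ : Set ℂ) := fun s hs ↦
    (differentiableAt_riemannZeta hs).differentiableWithinAt
  exact hdiff.analyticOnNhd isOpen_compl_singleton

/-- **`ord_{s=1/2} ζ(s)` is finite**: `ζ` is holomorphic on the connected open set `ℂ ∖ {1}`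
(Mathlib `differentiableAt_riemannZeta`) and `ζ(2) ≠ 0` (`riemannZeta_ne_zero_of_one_le_re`), so
`ζ` does not vanish identically near `1/2` (identity theorem). [cite: Titchmarsh1986, §2.1] -/
theorem analyticOrderAt_riemannZeta_half_ne_top :
    analyticOrderAt riemannZeta ((1 : ℂ) / 2) ≠ ⊤ := by
  have han : AnalyticOnNhd ℂ riemannZeta ({1}ᶜ : Set ℂ) := analyticOnNhd_riemannZeta_compl_one
  have hpc : IsPreconnected (({1} : Set ℂ)ᶜ) :=
    (isConnected_compl_singleton_of_one_lt_rank (rank_real_complex ▸ Nat.one_lt_ofNat) _)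
      |>.isPreconnected
  have h2 : analyticOrderAt riemannZeta 2 ≠ ⊤ := by
    rw [(han 2 (by norm_num)).analyticOrderAt_eq_zero.mpr
      (riemannZeta_ne_zero_of_one_le_re (by norm_num))]
    exact ENat.zero_ne_top
  exact han.analyticOrderAt_ne_top_of_isPreconnected hpc (by norm_num) (by norm_num) h2

/-- **The Riemann zeta function vanishes to even order at `s = 1/2`** (sign `+1` of the functional
equation `ξ(s) = ξ(1 - s)`). [cite: Titchmarsh1986, §2.6 (2.6.4)] -/
theorem even_analyticOrderNatAt_riemannZeta_half :
    Even (analyticOrderNatAt riemannZeta ((1 : ℂ) / 2)) := by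
  have h := even_analyticOrderNatAt_completedRiemannZeta_half
  simp only [analyticOrderNatAt, analyticOrderAt_riemannZeta_half_eq] at h ⊢
  exact h

/-- **A central zero of `ζ` would be at least double**: if `ζ(1/2) = 0` then `ord_{s=1/2} ζ ≥ 2`
(positive, finite, even order). [cite: Titchmarsh1986, §2.6 (2.6.4)] -/
theorem two_le_analyticOrderNatAt_riemannZeta_half_of_eq_zero (h0 : riemannZeta ((1 : ℂ) / 2) = 0) :
    2 ≤ analyticOrderNatAt riemannZeta ((1 : ℂ) / 2) := by
  obtain ⟨k, hk⟩ := even_analyticOrderNatAt_riemannZeta_half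
  have han : AnalyticAt ℂ riemannZeta ((1 : ℂ) / 2) :=
    analyticOnNhd_riemannZeta_compl_one _ (by norm_num)
  have hne : analyticOrderNatAt riemannZeta ((1 : ℂ) / 2) ≠ 0 := by
    intro h
    have h' : analyticOrderAt riemannZeta ((1 : ℂ) / 2) = 0 := by
      rw [← Nat.cast_analyticOrderNatAt analyticOrderAt_riemannZeta_half_ne_top, h, Nat.cast_zero]
    exact (han.analyticOrderAt_eq_zero.mp h') h0
  omega

end Literature.NumberTheory.LFunctions
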